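import Summits.AtomisticToContinuum.Crystallization.Theses.PeriodPrecisionLadder

/-!
# Route `PeriodPrecisionLadder`, item `ExactPeriodFromFine` (stmt-AtomisticToContinuum-25979): the dictionary is a theorem

**Fine almost periods at every precision, with uniform constants, give an exact period of a limit hull point**
(`exactPeriodFromFine_proof`, closing the route decl `PeriodPrecisionLadder.ExactPeriodFromFine`; the proof is the
route's evidence proof, decomp-a2c lens-3 gen 2, landed verbatim by gen 3 because the child node
`PeriodCoherenceLadder` consumes it in its deciding theorem).

* Block A — local-matching compactness of uniformly separated point sets of ℝ³ in sequential form with explicit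
  two-way matching clauses (Baake–Lenz 2004 / Baake–Grimm 2013 Remark 5.6; the statements of
  `Literature/…/LocalMatchingCompactness.lean` re-elaborated here because that module carries no olean on the hub):
  finiteness in balls, the (Kuratowski) lower limit set is separated, probe extraction of a subsequence along which
  cluster points are limit points, and the two-way eventual matching with ONE limit set.
* Block B — the dictionary: Bolzano–Weierstrass for the translations `t_n` (`a ≤ ‖t_n‖ ≤ b`), block A for the sets,
  separation makes the `η`-approximants of `y ± t∞` constant, and the hull is closed under local limits.
-/

noncomputable section

namespace Summit.AtomisticToContinuum.Crystallization.Theorems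

namespace PeriodPrecisionLadderExactPeriodFromFine

open Literature.MathematicalPhysics.StatisticalMechanics
open Filter Topology Metric

/-! ## A. Local-matching compactness (adapted verbatim from Literature `LocalMatchingCompactness`) -/

/-- A `δ`-separated subset (`δ > 0`) of a closed ball of ℝ³ is finite. [BaakeGrimm2013 §2.1; folklore] -/
theorem finite_of_forall_le_dist_of_subset_closedBall {S : Set (EuclideanSpace ℝ (Fin 3))}
    {δ : ℝ} (hδ : 0 < δ) (hsep : ∀ p ∈ S, ∀ q ∈ S, p ≠ q → δ ≤ dist p q)
    {c : EuclideanSpace ℝ (Fin 3)} {R : ℝ} (hS : S ⊆ closedBall c R) : S.Finite := by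
  by_contra hinf
  obtain ⟨a, -, ha⟩ :=
    Set.Infinite.exists_accPt_of_subset_isCompact hinf (isCompact_closedBall c R) hS
  rw [accPt_iff_nhds] at ha
  obtain ⟨y₁, ⟨hy₁U, hy₁S⟩, hy₁a⟩ := ha (ball a (δ / 2)) (ball_mem_nhds a (half_pos hδ))
  have hr : 0 < dist y₁ a := dist_pos.2 hy₁a
  obtain ⟨y₂, ⟨hy₂U, hy₂S⟩, -⟩ := ha (ball a (dist y₁ a)) (ball_mem_nhds a hr)
  rw [mem_ball] at hy₁U hy₂U
  have hne : y₁ ≠ y₂ := fun h => by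
    rw [h] at hy₂U
    exact lt_irrefl _ hy₂U
  have h1 := hsep y₁ hy₁S y₂ hy₂S hne
  have : dist y₁ y₂ < δ :=
    calc dist y₁ y₂ ≤ dist y₁ a + dist y₂ a := dist_triangle_right _ _ _
      _ < δ / 2 + δ / 2 := add_lt_add hy₁U (hy₂U.trans hy₁U)
      _ = δ := by ring
  linarith

/-- The limit set of `δ`-separated sets is `δ`-separated. [folklore] -/
theorem le_dist_of_mem_kuratowskiLiminf {Z : ℕ → Set (EuclideanSpace ℝ (Fin 3))} {δ : ℝ}
    (hsep : ∀ k, ∀ p ∈ Z k, ∀ q ∈ Z k, p ≠ q → δ ≤ dist p q)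
    {p q : EuclideanSpace ℝ (Fin 3)} (hp : p ∈ {p | ∀ ε : ℝ, 0 < ε → ∀ᶠ k in atTop, ∃ q ∈ Z k, dist q p < ε})
    (hq : q ∈ {p | ∀ ε : ℝ, 0 < ε → ∀ᶠ k in atTop, ∃ q ∈ Z k, dist q p < ε})
    (hpq : p ≠ q) : δ ≤ dist p q := by
  have hpq0 : 0 < dist p q := dist_pos.2 hpq
  refine le_of_forall_pos_lt_add fun η hη => ?_
  set ε : ℝ := min (η / 4) (dist p q / 4) with hε
  have hε0 : 0 < ε := lt_min (by linarith) (by linarith)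
  have hεη : ε ≤ η / 4 := min_le_left _ _
  have hεpq : ε ≤ dist p q / 4 := min_le_right _ _
  obtain ⟨k, ⟨a, ha, hap⟩, ⟨b, hb, hbq⟩⟩ := ((hp ε hε0).and (hq ε hε0)).exists
  by_cases hab : a = b
  · subst hab
    have : dist p q < 2 * ε :=
      calc dist p q ≤ dist a p + dist a q := dist_triangle_left _ _ _
        _ < ε + ε := add_lt_add hap hbq
        _ = 2 * ε := by ring
    linarith
  · have h1 := hsep k a ha b hb hab
    have : dist a b < dist p q + 2 * ε :=
      calc dist a b ≤ dist a p + dist p b := dist_triangle _ _ _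
        _ ≤ dist a p + (dist p q + dist b q) := add_le_add le_rfl (dist_triangle_right _ _ _)
        _ < ε + (dist p q + ε) := add_lt_add_of_lt_of_le hap (add_le_add le_rfl hbq.le)
        _ = dist p q + 2 * ε := by ring
    linarith

/-- **Probe extraction** (verbatim): a subsequence along which "frequently near `p`" implies "eventually
near `p`", i.e. membership in the Kuratowski lower limit. [folklore] -/
theorem exists_subseq_mem_kuratowskiLiminf_of_frequently
    (Ys : ℕ → Set (EuclideanSpace ℝ (Fin 3))) :
    ∃ φ : ℕ → ℕ, StrictMono φ ∧ ∀ p : EuclideanSpace ℝ (Fin 3),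
      (∀ ε : ℝ, 0 < ε → ∃ᶠ k in atTop, ∃ q ∈ Ys (φ k), dist q p < ε) →
        p ∈ {p | ∀ ε : ℝ, 0 < ε → ∀ᶠ k in atTop, ∃ q ∈ Ys (φ k), dist q p < ε} := by
  classical
  obtain ⟨u, hu⟩ := TopologicalSpace.exists_dense_seq (EuclideanSpace ℝ (Fin 3))
  let probe : ℕ → (ℕ × ℚ → Bool) := fun k nr =>
    decide (∃ q ∈ Ys k, dist q (u nr.1) < ((nr.2 : ℚ) : ℝ))
  obtain ⟨L, φ, hφ, hL⟩ := CompactSpace.tendsto_subseq probe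
  have hKey0 : ∀ (n : ℕ) (r : ℚ), (∃ᶠ k in atTop, ∃ q ∈ Ys (φ k), dist q (u n) < (r : ℝ)) →
      ∀ᶠ k in atTop, ∃ q ∈ Ys (φ k), dist q (u n) < (r : ℝ) := by
    intro n r hfr
    have ht : Tendsto (fun k => probe (φ k) (n, r)) atTop (𝓝 (L (n, r))) :=
      tendsto_pi_nhds.1 hL (n, r)
    rw [nhds_discrete Bool, tendsto_pure] at ht
    cases hLnr : L (n, r) with
    | true =>
      filter_upwards [ht] with k hk
      rw [hLnr] at hk
      simpa [probe] using hk
    | false =>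
      exfalso
      obtain ⟨k, hk1, hk2⟩ := (hfr.and_eventually ht).exists
      rw [hLnr] at hk2
      simp only [probe, decide_eq_false_iff_not] at hk2
      exact hk2 hk1
  refine ⟨φ, hφ, fun p hp ε hε => ?_⟩
  obtain ⟨r, hr0, hrε⟩ := exists_rat_btwn (half_pos hε)
  have hr0' : (0 : ℝ) < r := by exact_mod_cast hr0
  obtain ⟨n, hn⟩ := hu.exists_dist_lt p (half_pos hr0')
  have hfr : ∃ᶠ k in atTop, ∃ q ∈ Ys (φ k), dist q (u n) < (r : ℝ) := by
    refine (hp (r / 2) (half_pos hr0')).mono fun k ⟨q, hq, hqp⟩ => ⟨q, hq, ?_⟩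
    calc dist q (u n) ≤ dist q p + dist p (u n) := dist_triangle _ _ _
      _ < r / 2 + r / 2 := add_lt_add hqp hn
      _ = r := by ring
  filter_upwards [hKey0 n r hfr] with k ⟨q, hq, hqn⟩
  refine ⟨q, hq, ?_⟩
  calc dist q p ≤ dist q (u n) + dist p (u n) := dist_triangle_right _ _ _
    _ < r + r / 2 := add_lt_add hqn hn
    _ < ε := by linarith

/-- **Sequential compactness of `δ`-separated point sets of ℝ³ in the local matching topology**
(Baake–Lenz 2004; BaakeGrimm2013 Remark 5.6; verbatim adaptation, norm form of the ball): along a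
subsequence the sets are eventually two-way `ε`-matched on `‖·‖ ≤ R` with one `δ`-separated limit set `Y`,
for every `R` and every `ε > 0`. [folklore] -/
theorem exists_subseq_forall_eventually_match {δ : ℝ} (hδ : 0 < δ)
    (Ys : ℕ → Set (EuclideanSpace ℝ (Fin 3)))
    (hsep : ∀ k, ∀ p ∈ Ys k, ∀ q ∈ Ys k, p ≠ q → δ ≤ dist p q) :
    ∃ (φ : ℕ → ℕ) (Y : Set (EuclideanSpace ℝ (Fin 3))), StrictMono φ ∧
      (∀ p ∈ Y, ∀ q ∈ Y, p ≠ q → δ ≤ dist p q) ∧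
      ∀ R ε : ℝ, 0 < ε → ∀ᶠ k in atTop,
        (∀ s ∈ Y, ‖s‖ ≤ R → ∃ a ∈ Ys (φ k), dist a s ≤ ε) ∧
        (∀ a ∈ Ys (φ k), ‖a‖ ≤ R → ∃ s ∈ Y, dist a s ≤ ε) := by
  obtain ⟨φ, hφ, hKey⟩ := exists_subseq_mem_kuratowskiLiminf_of_frequently Ys
  set Y : Set (EuclideanSpace ℝ (Fin 3)) := {p | ∀ ε : ℝ, 0 < ε → ∀ᶠ k in atTop, ∃ q ∈ Ys (φ k), dist q p < ε} with hY
  have hsepφ : ∀ k, ∀ p ∈ Ys (φ k), ∀ q ∈ Ys (φ k), p ≠ q → δ ≤ dist p q := fun k => hsep (φ k)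
  have hYsep : ∀ p ∈ Y, ∀ q ∈ Y, p ≠ q → δ ≤ dist p q :=
    fun p hp q hq hpq => le_dist_of_mem_kuratowskiLiminf hsepφ hp hq hpq
  refine ⟨φ, Y, hφ, hYsep, fun R ε hε => ?_⟩
  have hfin : (Y ∩ closedBall 0 R).Finite :=
    finite_of_forall_le_dist_of_subset_closedBall hδ
      (fun p hp q hq hpq => hYsep p hp.1 q hq.1 hpq) Set.inter_subset_right
  have h1 : ∀ᶠ k in atTop, ∀ p ∈ Y ∩ closedBall (0 : EuclideanSpace ℝ (Fin 3)) R,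
      ∃ q ∈ Ys (φ k), dist q p < ε :=
    hfin.eventually_all.2 fun p hp => hp.1 ε hε
  have h2 : ∀ᶠ k in atTop, ∀ q ∈ Ys (φ k), ‖q‖ ≤ R → ∃ p ∈ Y, dist q p ≤ ε := by
    by_contra hcon
    obtain ⟨ψ, hψ, hψP⟩ := extraction_of_frequently_atTop (not_eventually.1 hcon)
    have hq : ∀ l, ∃ q ∈ Ys (φ (ψ l)), ‖q‖ ≤ R ∧ ∀ p ∈ Y, ε < dist q p := by
      intro l
      have := hψP l
      push Not at this
      exact this
    choose q hqY hqR hfar using hq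
    obtain ⟨a, -, θ, hθ, hlimq⟩ :=
      (isCompact_closedBall (0 : EuclideanSpace ℝ (Fin 3)) R).tendsto_subseq (x := q)
        fun l => mem_closedBall_zero_iff.2 (hqR l)
    have ha : a ∈ Y := by
      refine hKey a fun ε' hε' => ?_
      have hi : ∀ᶠ i in atTop, dist (q (θ i)) a < ε' := Metric.tendsto_nhds.1 hlimq ε' hε'
      refine frequently_atTop.2 fun K => ?_
      obtain ⟨i, hi', hiK⟩ := (hi.and (eventually_ge_atTop K)).exists
      exact ⟨ψ (θ i), hiK.trans (hθ.le_apply.trans hψ.le_apply), q (θ i), hqY (θ i), hi'⟩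
    obtain ⟨i, hi⟩ := (Metric.tendsto_nhds.1 hlimq ε hε).exists
    exact lt_irrefl _ ((hfar (θ i) a ha).trans hi)
  filter_upwards [h1, h2] with k hk1 hk2
  refine ⟨fun s hs hsR => ?_, fun a ha haR => hk2 a ha haR⟩
  obtain ⟨b, hb, hbs⟩ := hk1 s ⟨hs, mem_closedBall_zero_iff.2 hsR⟩
  exact ⟨b, hb, hbs.le⟩


/-! ## B. The dictionary -/

/-- **`ExactPeriodFromFine` holds** (the certified EQUIV of the node, direction fine ⇒ exact).  Given, with
uniform constants, at every precision `1/(n+1)` a `δ`-separated `r`-dense hull point `X_n` and a translation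
`t_n` (`a ≤ ‖t_n‖ ≤ b`) moving `X_n` into itself up to `1/(n+1)` (two-sidedly): Bolzano–Weierstrass gives
`t_n → t∞ ≠ 0` along `φ₁`; block A gives a `δ`-separated local limit `Y` of `X ∘ φ₁ ∘ φ₂`; `Y` is
`(r+1)`-dense; for `y ∈ Y` the points of `Y` within `η` of `y ± t∞` exist for every `η > 0` (match `y` to
`p ∈ X_k`, move by `t_k`, match back) and are CONSTANT for `η < δ/2` by separation, so `y ± t∞ ∈ Y`; and `Y`
is a hull point because the hull is closed under local limits (compose the two matchings, radius slack `ε`).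
[BaakeGrimm2013 Remark 5.6 and Prop. 5.3 (hull closed); folklore] -/
theorem exactPeriodFromFine_proof :
    Summit.AtomisticToContinuum.Crystallization.Theses.PeriodPrecisionLadder.ExactPeriodFromFine := by
  rintro x ⟨δ, r, a, b, hδ, ha, H⟩
  -- data at precision 1/(n+1)
  have H' : ∀ n : ℕ, ∃ (X : Set (EuclideanSpace ℝ (Fin 3))) (t : EuclideanSpace ℝ (Fin 3)),
      (∀ p ∈ X, ∀ q ∈ X, p ≠ q → δ ≤ dist p q) ∧
      (∀ c : EuclideanSpace ℝ (Fin 3), ∃ p ∈ X, dist p c ≤ r) ∧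
      (∀ R ε' : ℝ, 0 < ε' → ∃ᶠ N in Filter.atTop, ∃ s : EuclideanSpace ℝ (Fin 3),
        (∀ p ∈ X, ‖p‖ ≤ R → ∃ i : Fin N, dist (x N i + s) p ≤ ε') ∧
        (∀ i : Fin N, ‖x N i + s‖ ≤ R → ∃ p ∈ X, dist (x N i + s) p ≤ ε')) ∧
      a ≤ ‖t‖ ∧ ‖t‖ ≤ b ∧
      ∀ p ∈ X, (∃ q ∈ X, dist (p + t) q ≤ 1 / ((n : ℝ) + 1)) ∧
        (∃ q ∈ X, dist (p - t) q ≤ 1 / ((n : ℝ) + 1)) := by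
    intro n
    obtain ⟨X, hs, hd, hh, t, hta, htb, hap⟩ := H (1 / ((n : ℝ) + 1)) (by positivity)
    exact ⟨X, t, hs, hd, hh, hta, htb, hap⟩
  choose X t hsep hden hhull hta htb hAP using H'
  have hb : 0 ≤ b := le_trans (norm_nonneg _) (htb 0)
  -- Bolzano–Weierstrass for the translations
  obtain ⟨tinf, -, φ₁, hφ₁, hlim⟩ := tendsto_subseq_of_bounded
    (Metric.isBounded_closedBall : Bornology.IsBounded (closedBall (0 : EuclideanSpace ℝ (Fin 3)) b))
    (fun n => mem_closedBall_zero_iff.2 (htb n))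
  have hta_inf : a ≤ ‖tinf‖ :=
    ge_of_tendsto hlim.norm (Eventually.of_forall fun n => hta (φ₁ n))
  have htinf_ne : tinf ≠ 0 := by
    intro h
    rw [h, norm_zero] at hta_inf
    linarith
  -- local-matching compactness for the sets along φ₁
  obtain ⟨φ₂, Y, hφ₂, hYsep, hmatch⟩ :=
    exists_subseq_forall_eventually_match hδ (fun n => X (φ₁ n)) (fun n => hsep (φ₁ n))
  have hlimψ : Tendsto (fun k => t (φ₁ (φ₂ k))) atTop (𝓝 tinf) := hlim.comp hφ₂.tendsto_atTop
  have hψmono : StrictMono (fun k => φ₁ (φ₂ k)) := hφ₁.comp hφ₂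
  -- the precision along the subsequence tends to zero
  have hprec : ∀ η : ℝ, 0 < η → ∀ᶠ k in atTop, 1 / ((φ₁ (φ₂ k) : ℝ) + 1) ≤ η := by
    intro η hη
    have h1 : Tendsto (fun k : ℕ => (1 : ℝ) / ((k : ℝ) + 1)) atTop (𝓝 0) :=
      tendsto_one_div_add_atTop_nhds_zero_nat
    have h2 : Tendsto (fun k : ℕ => (1 : ℝ) / (((φ₁ (φ₂ k) : ℕ) : ℝ) + 1)) atTop (𝓝 0) :=
      h1.comp hψmono.tendsto_atTop
    exact h2.eventually (eventually_le_nhds hη)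
  -- (i) Y is (r+1)-dense
  have hYden : ∀ c : EuclideanSpace ℝ (Fin 3), ∃ p ∈ Y, dist p c ≤ r + 1 := by
    intro c
    obtain ⟨k, hk⟩ := (hmatch (‖c‖ + r) 1 one_pos).exists
    obtain ⟨p, hp, hpc⟩ := hden (φ₁ (φ₂ k)) c
    have hpn : ‖p‖ ≤ ‖c‖ + r := by
      have h1 : ‖p‖ ≤ ‖c‖ + dist p c := by
        have := norm_le_norm_add_norm_sub' p c
        rwa [← dist_eq_norm] at this
      linarith
    obtain ⟨s, hs, hps⟩ := hk.2 p hp hpn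
    refine ⟨s, hs, ?_⟩
    calc dist s c ≤ dist p s + dist p c := dist_triangle_left _ _ _
      _ ≤ 1 + r := add_le_add hps hpc
      _ = r + 1 := add_comm _ _
  -- (ii) Y has the exact two-sided period tinf
  have hper : ∀ y ∈ Y, y + tinf ∈ Y ∧ y - tinf ∈ Y := by
    intro y hy
    have key : ∀ η : ℝ, 0 < η →
        (∃ y' ∈ Y, dist (y + tinf) y' ≤ η) ∧ (∃ y' ∈ Y, dist (y - tinf) y' ≤ η) := by
      intro η hη
      have e1 := hmatch (‖y‖ + b + η) (η / 4) (by positivity)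
      have e2 := hprec (η / 4) (by positivity)
      have e3 : ∀ᶠ k in atTop, dist (t (φ₁ (φ₂ k))) tinf ≤ η / 4 :=
        (Metric.tendsto_nhds.1 hlimψ (η / 4) (by positivity)).mono fun k hk => hk.le
      obtain ⟨k, hk1, hk2, hk3⟩ := (e1.and (e2.and e3)).exists
      have hyn : ‖y‖ ≤ ‖y‖ + b + η := by linarith
      obtain ⟨p, hp, hpy⟩ := hk1.1 y hy hyn
      obtain ⟨⟨q₁, hq₁, hq₁d⟩, ⟨q₂, hq₂, hq₂d⟩⟩ := hAP (φ₁ (φ₂ k)) p hp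
      have hpn : ‖p‖ ≤ ‖y‖ + η / 4 := by
        have h1 : ‖p‖ ≤ ‖y‖ + dist p y := by
          have := norm_le_norm_add_norm_sub' p y
          rwa [← dist_eq_norm] at this
        linarith
      have htk : ‖t (φ₁ (φ₂ k))‖ ≤ b := htb _
      have hq₁n : ‖q₁‖ ≤ ‖y‖ + b + η := by
        have h1 : ‖q₁‖ ≤ ‖p + t (φ₁ (φ₂ k))‖ + dist q₁ (p + t (φ₁ (φ₂ k))) := by
          have := norm_le_norm_add_norm_sub' q₁ (p + t (φ₁ (φ₂ k)))
          rwa [← dist_eq_norm] at this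
        have h2 : ‖p + t (φ₁ (φ₂ k))‖ ≤ ‖p‖ + ‖t (φ₁ (φ₂ k))‖ := norm_add_le _ _
        rw [dist_comm] at h1
        linarith
      have hq₂n : ‖q₂‖ ≤ ‖y‖ + b + η := by
        have h1 : ‖q₂‖ ≤ ‖p - t (φ₁ (φ₂ k))‖ + dist q₂ (p - t (φ₁ (φ₂ k))) := by
          have := norm_le_norm_add_norm_sub' q₂ (p - t (φ₁ (φ₂ k)))
          rwa [← dist_eq_norm] at this
        have h2 : ‖p - t (φ₁ (φ₂ k))‖ ≤ ‖p‖ + ‖t (φ₁ (φ₂ k))‖ := norm_sub_le _ _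
        rw [dist_comm] at h1
        linarith
      obtain ⟨y₁, hy₁, hqy₁⟩ := hk1.2 q₁ hq₁ hq₁n
      obtain ⟨y₂, hy₂, hqy₂⟩ := hk1.2 q₂ hq₂ hq₂n
      refine ⟨⟨y₁, hy₁, ?_⟩, ⟨y₂, hy₂, ?_⟩⟩
      · calc dist (y + tinf) y₁
            ≤ dist (y + tinf) (p + t (φ₁ (φ₂ k))) + dist (p + t (φ₁ (φ₂ k))) y₁ := dist_triangle _ _ _
          _ ≤ (dist y p + dist tinf (t (φ₁ (φ₂ k)))) + (dist (p + t (φ₁ (φ₂ k))) q₁ + dist q₁ y₁) :=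
              add_le_add (dist_add_add_le _ _ _ _) (dist_triangle _ _ _)
          _ ≤ (η / 4 + η / 4) + (η / 4 + η / 4) := by
              gcongr
              · rwa [dist_comm] at hpy
              · rwa [dist_comm] at hk3
              · exact hq₁d.trans hk2
          _ = η := by ring
      · calc dist (y - tinf) y₂
            ≤ dist (y - tinf) (p - t (φ₁ (φ₂ k))) + dist (p - t (φ₁ (φ₂ k))) y₂ := dist_triangle _ _ _
          _ ≤ (dist y p + dist tinf (t (φ₁ (φ₂ k)))) + (dist (p - t (φ₁ (φ₂ k))) q₂ + dist q₂ y₂) :=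
              add_le_add (dist_sub_sub_le _ _ _ _) (dist_triangle _ _ _)
          _ ≤ (η / 4 + η / 4) + (η / 4 + η / 4) := by
              gcongr
              · rwa [dist_comm] at hpy
              · rwa [dist_comm] at hk3
              · exact hq₂d.trans hk2
          _ = η := by ring
    -- separation: the approximants are constant below δ/2, hence exact
    obtain ⟨⟨y₁, hy₁, hd₁⟩, ⟨y₂, hy₂, hd₂⟩⟩ := key (δ / 4) (by positivity)
    have hclose₁ : ∀ η : ℝ, 0 < η → dist (y + tinf) y₁ ≤ η := by
      intro η hη
      obtain ⟨⟨y', hy', hd'⟩, -⟩ := key (min η (δ / 4)) (by positivity)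
      by_cases h : y' = y₁
      · rw [← h]
        exact hd'.trans (min_le_left _ _)
      · exfalso
        have h1 := hYsep y' hy' y₁ hy₁ h
        have h2 : dist y' y₁ ≤ dist (y + tinf) y' + dist (y + tinf) y₁ := dist_triangle_left _ _ _
        have h3 := min_le_right η (δ / 4)
        linarith
    have hclose₂ : ∀ η : ℝ, 0 < η → dist (y - tinf) y₂ ≤ η := by
      intro η hη
      obtain ⟨-, ⟨y', hy', hd'⟩⟩ := key (min η (δ / 4)) (by positivity)
      by_cases h : y' = y₂
      · rw [← h]
        exact hd'.trans (min_le_left _ _)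
      · exfalso
        have h1 := hYsep y' hy' y₂ hy₂ h
        have h2 : dist y' y₂ ≤ dist (y - tinf) y' + dist (y - tinf) y₂ := dist_triangle_left _ _ _
        have h3 := min_le_right η (δ / 4)
        linarith
    have he₁ : y + tinf = y₁ := by
      refine dist_le_zero.1 (le_of_forall_pos_le_add fun η hη => ?_)
      rw [zero_add]
      exact hclose₁ η hη
    have he₂ : y - tinf = y₂ := by
      refine dist_le_zero.1 (le_of_forall_pos_le_add fun η hη => ?_)
      rw [zero_add]
      exact hclose₂ η hη
    exact ⟨he₁ ▸ hy₁, he₂ ▸ hy₂⟩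
  -- (iii) Y is a hull point (the hull is closed under local limits)
  have hYhull : ∀ R ε : ℝ, 0 < ε → ∃ᶠ N in Filter.atTop, ∃ s : EuclideanSpace ℝ (Fin 3),
      (∀ p ∈ Y, ‖p‖ ≤ R → ∃ i : Fin N, dist (x N i + s) p ≤ ε) ∧
      (∀ i : Fin N, ‖x N i + s‖ ≤ R → ∃ p ∈ Y, dist (x N i + s) p ≤ ε) := by
    intro R ε hε
    obtain ⟨k, hk⟩ := (hmatch (R + ε) (ε / 2) (by positivity)).exists
    refine (hhull (φ₁ (φ₂ k)) (R + ε) (ε / 2) (by positivity)).mono ?_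
    rintro N ⟨s, hs1, hs2⟩
    refine ⟨s, fun p hp hpR => ?_, fun i hi => ?_⟩
    · obtain ⟨q, hq, hqp⟩ := hk.1 p hp (by linarith)
      have hqR : ‖q‖ ≤ R + ε := by
        have h1 : ‖q‖ ≤ ‖p‖ + dist q p := by
          have := norm_le_norm_add_norm_sub' q p
          rwa [← dist_eq_norm] at this
        linarith
      obtain ⟨i, hi⟩ := hs1 q hq hqR
      exact ⟨i, (dist_triangle _ q _).trans (by linarith)⟩
    · obtain ⟨q, hq, hiq⟩ := hs2 i (by linarith)
      have hqR : ‖q‖ ≤ R + ε := by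
        have h1 : ‖q‖ ≤ ‖x N i + s‖ + dist q (x N i + s) := by
          have := norm_le_norm_add_norm_sub' q (x N i + s)
          rwa [← dist_eq_norm] at this
        rw [dist_comm] at h1
        linarith
      obtain ⟨p, hp, hqp⟩ := hk.2 q hq hqR
      exact ⟨p, hp, (dist_triangle _ q _).trans (by linarith)⟩
  -- (iv) assemble
  refine ⟨Y, ⟨⟨δ, hδ, hYsep⟩, ⟨r + 1, hYden⟩⟩, ⟨fun _ => tinf, ?_, fun _ p hp => hper p hp⟩, hYhull⟩
  rw [linearIndependent_unique_iff]
  exact htinf_ne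

end PeriodPrecisionLadderExactPeriodFromFine

end Summit.AtomisticToContinuum.Crystallization.Theorems

end
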